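/-
Copyright (c) 2026 the pub-hodgecm-mathlib formalisation cell (harness21).  Prover seat hodgecm-mathlib-LH4-p17 (g0), req620 Track A «(D-RAM) FOUR-FRAME» squad, helper lane on
h413 = stmt-HodgeConjecture-24833 (count-neutral).  β-BOARD v1 (sub-dealer LH4-p05 (g8)) row R3 «G₁ ε-BOUNDARY TOWER FILE», FILE 3b: the slot-`2` indicator of the label
character on the glued representative `latt V(1,1,g)` beyond the one-slot cell.  2026-09-04.
-/
import Summits.HodgeConjecture.HodgeConjecture.Theorems.F0P3cDyRamLabelledOddGluedCharacter   -- ★ p861560 (this seat, FILE 3): `ratios_of_mem_fixedUnitStabilizer_glued_rep`, the killer carrier; brings ★ κG-A2, ★ toolkit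
import HarnessLib

/-!
# Crux `H413`, line LH4 «(D-RAM) FOUR-FRAME» — (β) Stage B, R3 FILE 3b «THE THIRD-SLOT INDICATOR OF THE GLUED LABEL CHARACTER»

Cell `hodgecm-mathlib` (D-0151), FLOOR 0, crux item H413 = `stmt-HodgeConjecture-24833`, route `HCCMUnconditional`; squad F0∕P3c∕LH4.  THEOREMS ONLY (no `def`, no instance, no
notation, no `sorry`, default heartbeats); ★-only imports; lane `--supports stmt-HodgeConjecture-24833 --as helper` (count-neutral); pays NO row, states NO law.

THE MATHEMATICS (β-BOARD v1 R3; [Kottwitz1986BaseChangeUnits, §1], [LanglandsShelstad1987, §3], [Serre1979, V §3 ∕ XV §2]).  With the label character of ★ FILE 3,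
`λ_c(u) = ω(u₁)·ω(1 + c·(u₀∕u₁ − 1))`, `c = rg∕(1+rg)`, the third-slot character `ω(u₂)·λ_c(u)` of ★ p861456's HEAD sees the corner congruence of `S_F(latt V(1,1,g))`
(`u₀∕u₁ − 1 ≡ (u₂∕u₁ − 1)(1+g)∕g (ϖ^{2ρ})`), and the EXACT identity `1 − r + r(1+g)y = (1+rg)·y·(1 + κ(1 − 1∕y))`, `κ = (r−1)∕(1+rg)`, turns it into
* §2 `normSign_two_mul_gluedChar_eq`: `ω(u₂)·λ_c(u) = ω(1 + κ·(1 − u₁∕u₂))` on `S_F` (the square `y² = (u₂∕u₁)²` dies under `ω`; conductor `2d ≤ Δ + 2ρ + 1` for `|rg| ≤ |ϖ|^Δ`),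
so that (`u₂∕u₁` sweeping `U^{[ρ+2t]}` along `S_F`, §1 the carrier `(1 + e(1+g)∕g, 1, 1+e)`)
* §3 `forall_normSign_two_mul_gluedChar_of_le`: `|κ|·|ϖ|^{ρ+2t} ≤ |ϖ|^{2d−1}` ⟹ `ω₂·λ_c ≡ 1` on `S_F`; `exists_normSign_two_mul_gluedChar_ne_one`: `|ϖ|^{2d−2} ≤ |κ|·|ϖ|^{ρ+2t}`
  ⟹ some `u ∈ S_F` has `ω(u₂)·λ_c(u) = −1` (the non-norm `n₀ ≡ 1 (ϖ^{2d−2})` of ★ `exists_fixed_unit_not_norm_v_sub_one_le` at `1 − u₁∕u₂ = (n₀−1)∕κ`).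
In the R3 assembly `|κ|·|ϖ|^{ρ+2t} = |ϖ|^{ρ + (n₃ − ℓ₀ − 2ρ)}` (`|r − 1| = |g_α − g_β|∕|g_β|`), i.e. the indicator is `[2d ≤ ρ + (n₃ − ℓ₀ − 2ρ) + 1]` — uniformly in the three regimes
`n₁ <, =, > n₂`.  HONEST LABEL.  Count-neutral; proves no census ((β-BAL)∕(β)∕T₊ OPEN); `HC_CM` is proved only modulo the 7 printed citations (2 remaining named inputs: hLiu418 =
`stmt-HodgeConjecture-24832`, h413 = `stmt-HodgeConjecture-24833`) until rung 0 closes.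
-/

set_option autoImplicit false

noncomputable section

namespace Summit.HodgeConjecture.HodgeConjecture.Cruxes.H413.F0P3cDyRamLabelledOddGluedCharacterTwo

open Matrix WithZero
open Literature.NumberTheory.Automorphic Literature.NumberTheory.Automorphic.HermitianLattice Literature.NumberTheory.Automorphic.UnitaryGroup
open Literature.NumberTheory.Automorphic.UnitaryLatticeTree Literature.NumberTheory.Automorphic.UnitaryThreeFourFrame
open Literature.NumberTheory.LocalFields.WildQuadraticDatum
open Summit.HodgeConjecture.HodgeConjecture.Cruxes.H413.F0P3cDyRamDiagonalTorusDefs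
open Summit.HodgeConjecture.HodgeConjecture.Cruxes.H413.F0P3cDyRamDiagonalKappaGluedClass (mem_fixedUnitStabilizer_glued_rep_iff)
open Summit.HodgeConjecture.HodgeConjecture.Cruxes.H413.F0P3cDyRamFixedCountDiagonalModel (normSign_mul_norm)
open Summit.HodgeConjecture.HodgeConjecture.Cruxes.H413.F0P3cDyRamDiagonalKappaSplitCountEval (normSign_mul_self)
open Summit.HodgeConjecture.HodgeConjecture.Cruxes.H413.F0P3cDyRamLabelledOddGluedCharacter (ratios_of_mem_fixedUnitStabilizer_glued_rep)
open scoped Valued WithZero Matrix MatrixGroups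

variable {K : Type} [Field K] [Valued K ℤᵐ⁰]

/-! ## §1  The carrier of a third-slot ratio: `u = (1 + e(1+g)∕g, 1, 1 + e) ∈ S_F` for `|e| ≤ |ϖ|^{ρ+2t}` -/

/-- **THE THIRD-SLOT CARRIER**: for a fixed `e` with `|e| ≤ |ϖ|^{ρ+2t}` (`ρ, t ≥ 1`), `u = (1 + e(1+g)∕g, 1, 1 + e)` is a fixed unit diagonal in `S_F(latt V(1,1,g))` (`|u₂ − u₁| = |e|`, corner
vanishing EXACTLY) with `u₂∕u₁ − 1 = e`. [cite: Kottwitz1986BaseChangeUnits, §1 pp. 240–241] -/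
theorem exists_mem_fixedUnitStabilizer_glued_rep_of_ratio₂ {σ : K →+* K} {ϖ : K} (hϖ0 : ϖ ≠ 0) (hϖ1 : Valued.v ϖ < 1) {ρ t : ℕ} (hρ : 1 ≤ ρ) (ht : 1 ≤ t)
    {g : K} (hσg : σ g = g) (hg : Valued.v g = Valued.v ϖ ^ (2 * t)) (V : GL (Fin 3) K)
    (hV : (V : Matrix (Fin 3) (Fin 3) K) = !![1, 0, 0; 1, ϖ ^ ρ, 0; 1 * 1 + g, ϖ ^ ρ * 1, ϖ ^ (2 * ρ + 2 * t)])
    {e : K} (hσe : σ e = e) (he : Valued.v e ≤ Valued.v ϖ ^ (ρ + 2 * t)) :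
    ∃ u ∈ fixedUnitStabilizer σ (latt (V : Matrix (Fin 3) (Fin 3) K)), ((u 0 : Kˣ) : K) = 1 + e * (1 + g) / g ∧ ((u 1 : Kˣ) : K) = 1 ∧ ((u 2 : Kˣ) : K) = 1 + e := by
  have hvϖ : 0 < Valued.v ϖ := (Valuation.pos_iff _).2 hϖ0
  have hg0 : g ≠ 0 := fun h => by rw [h, map_zero] at hg; exact (pow_ne_zero _ hvϖ.ne') hg.symm
  have hglt : Valued.v g < 1 := by rw [hg]; exact pow_lt_one₀ zero_le hϖ1 (by omega)
  have h1g : Valued.v (1 + g) = 1 := Valued.v.map_one_add_of_lt hglt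
  have helt : Valued.v e < 1 := he.trans_lt (pow_lt_one₀ zero_le hϖ1 (by omega))
  have hu2v : Valued.v (1 + e) = 1 := Valued.v.map_one_add_of_lt helt
  have hu20 : (1 : K) + e ≠ 0 := fun h => by rw [h, map_zero] at hu2v; exact zero_ne_one hu2v
  have hw : Valued.v (e * (1 + g) / g) ≤ Valued.v ϖ ^ ρ := by
    rw [map_div₀, map_mul, h1g, mul_one, hg, div_le_iff₀ (pow_pos hvϖ _), ← pow_add]; exact he
  have hwlt : Valued.v (e * (1 + g) / g) < 1 := hw.trans_lt (pow_lt_one₀ zero_le hϖ1 (by omega))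
  have hu0v : Valued.v (1 + e * (1 + g) / g) = 1 := Valued.v.map_one_add_of_lt hwlt
  have hu00 : (1 : K) + e * (1 + g) / g ≠ 0 := fun h => by rw [h, map_zero] at hu0v; exact zero_ne_one hu0v
  let u : Fin 3 → Kˣ := ![Units.mk0 (1 + e * (1 + g) / g) hu00, 1, Units.mk0 (1 + e) hu20]
  have hu0 : ((u 0 : Kˣ) : K) = 1 + e * (1 + g) / g := rfl
  have hu1 : ((u 1 : Kˣ) : K) = 1 := rfl
  have hu2 : ((u 2 : Kˣ) : K) = 1 + e := rfl
  have huT : u ∈ fixedUnitTorus σ 3 := by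
    rw [mem_fixedUnitTorus_iff]
    refine ⟨fun i => ?_, fun i => ?_⟩
    · fin_cases i
      · exact hu0v
      · exact map_one _
      · exact hu2v
    · fin_cases i
      · show σ (1 + e * (1 + g) / g) = 1 + e * (1 + g) / g
        rw [map_add, map_one, map_div₀, map_mul, map_add, map_one, hσe, hσg]
      · exact map_one σ
      · show σ (1 + e) = 1 + e
        rw [map_add, map_one, hσe]
  refine ⟨u, (mem_fixedUnitStabilizer_glued_rep_iff hϖ0 hϖ1.le ρ t hg V hV huT).2 ⟨?_, ?_⟩, hu0, hu1, hu2⟩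
  · rw [hu2, hu1, add_sub_cancel_left]; exact he
  · rw [hu2, hu1, hu0, show g⁻¹ * (1 + e - 1) + (1 + e - (1 + e * (1 + g) / g)) = 0 by field_simp; ring, map_zero]
    exact zero_le

/-! ## §2  The third-slot character on `S_F`: `ω(u₂)·λ_c(u) = ω(1 + κ·(1 − u₁∕u₂))` -/

section Character

variable [CompleteSpace K] [Finite 𝓀[K]] {σ : K →+* K} {ϖ : K} {d t₂ : ℕ}

/-- **THE THIRD-SLOT CHARACTER ON `S_F(latt V(1,1,g))`**: for `r, g` fixed with `|rg| ≤ |ϖ|^Δ`, `Δ ≥ 1`, `2d ≤ Δ + 2ρ + 1`, `c = rg∕(1+rg)`, `κ = (r−1)∕(1+rg)`, and `u ∈ S_F`: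
`ω(u₂)·(ω(u₁)·ω(1 + c·(u₀∕u₁ − 1))) = ω(1 + κ·(1 − u₁∕u₂))` — the corner congruence replaces `u₀∕u₁ − 1` by `(u₂∕u₁ − 1)(1+g)∕g` below the conductor, and
`1 + c(y−1)(1+g)∕g = y·(1 + κ(1 − 1∕y))` exactly (`y = u₂∕u₁`; `ω(u₂)ω(u₁) = ω(y)`, `ω(y)² = 1`). [cite: Kottwitz1986BaseChangeUnits, §1 pp. 240–241] [cite: Serre1979, Ch. XV §2] -/
theorem normSign_two_mul_gluedChar_eq (hD : IsRamifiedQuadraticDatum σ ϖ d t₂) {ρ t : ℕ} (hρ : 1 ≤ ρ) (ht : 1 ≤ t)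
    {g : K} (hσg : σ g = g) (hg : Valued.v g = Valued.v ϖ ^ (2 * t))
    (V : GL (Fin 3) K) (hV : (V : Matrix (Fin 3) (Fin 3) K) = !![1, 0, 0; 1, ϖ ^ ρ, 0; 1 * 1 + g, ϖ ^ ρ * 1, ϖ ^ (2 * ρ + 2 * t)])
    {r : K} (hσr : σ r = r) {Δ : ℕ} (hΔ1 : 1 ≤ Δ) (hrg : Valued.v (r * g) ≤ Valued.v ϖ ^ Δ) (hΔ : 2 * d ≤ Δ + 2 * ρ + 1)
    {u : Fin 3 → Kˣ} (hu : u ∈ fixedUnitStabilizer σ (latt (V : Matrix (Fin 3) (Fin 3) K))) :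
    normSign σ ((u 2 : Kˣ) : K) * (normSign σ ((u 1 : Kˣ) : K) * normSign σ (1 + r * g / (1 + r * g) * (((u 0 : Kˣ) : K) / ((u 1 : Kˣ) : K) - 1))) =
      normSign σ (1 + (r - 1) / (1 + r * g) * (1 - ((u 1 : Kˣ) : K) / ((u 2 : Kˣ) : K))) := by
  obtain ⟨hσ, hvσ, hϖ, -, -, -, -⟩ := id hD
  have hϖ0 : ϖ ≠ 0 := (Valuation.ne_zero_iff Valued.v).1 (by rw [hϖ]; exact exp_ne_zero)
  have hvϖ : 0 < Valued.v ϖ := (Valuation.pos_iff _).2 hϖ0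
  have hϖ1 : Valued.v ϖ < 1 := by rw [hϖ, ← exp_zero, exp_lt_exp]; norm_num
  have hϖle : ∀ n : ℕ, Valued.v ϖ ^ n ≤ 1 := fun n => pow_le_one₀ zero_le hϖ1.le
  obtain ⟨-, hu1, hu2⟩ := (mem_fixedUnitStabilizer_iff σ _ u).1 hu
  have h0 : ∀ j, ((u j : Kˣ) : K) ≠ 0 := fun j => (u j).ne_zero
  have hg0 : g ≠ 0 := fun h => by rw [h, map_zero] at hg; exact (pow_ne_zero _ hvϖ.ne') hg.symm
  have hglt : Valued.v g < 1 := by rw [hg]; exact pow_lt_one₀ zero_le hϖ1 (by omega)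
  have h1g : Valued.v (1 + g) = 1 := Valued.v.map_one_add_of_lt hglt
  have h1g0 : (1 : K) + g ≠ 0 := fun h => by rw [h, map_zero] at h1g; exact zero_ne_one h1g
  -- `rg`, `1 + rg`, `c`
  have hrglt : Valued.v (r * g) < 1 := hrg.trans_lt (pow_lt_one₀ zero_le hϖ1 (by omega))
  have h1rg : Valued.v (1 + r * g) = 1 := Valued.v.map_one_add_of_lt hrglt
  have h1rg0 : (1 : K) + r * g ≠ 0 := fun h => by rw [h, map_zero] at h1rg; exact zero_ne_one h1rg
  have hσ1rg : σ (1 + r * g) = 1 + r * g := by rw [map_add, map_one, map_mul, hσr, hσg]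
  set c : K := r * g / (1 + r * g) with hcdef
  have hσc : σ c = c := by rw [hcdef, map_div₀, map_mul, hσr, hσg, hσ1rg]
  have hvc : Valued.v c ≤ Valued.v ϖ ^ Δ := by rw [hcdef, map_div₀, h1rg, div_one]; exact hrg
  -- the ratios
  set y : K := ((u 2 : Kˣ) : K) / ((u 1 : Kˣ) : K) with hydef
  set v : K := ((u 0 : Kˣ) : K) / ((u 1 : Kˣ) : K) with hvdef
  have hσy : σ y = y := by rw [hydef, map_div₀, hu2, hu2]
  have hσv : σ v = v := by rw [hvdef, map_div₀, hu2, hu2]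
  have hy1 : Valued.v y = 1 := by rw [hydef, map_div₀, hu1, hu1, div_one]
  have hy0 : y ≠ 0 := div_ne_zero (h0 2) (h0 1)
  obtain ⟨hvρ, hyρ, hcorner⟩ := ratios_of_mem_fixedUnitStabilizer_glued_rep (σ := σ) hϖ0 hϖ1 ht hg V hV hu
  rw [← hvdef] at hvρ hcorner
  rw [← hydef] at hyρ hcorner
  -- `ω(u₂)·ω(u₁) = ω(y)`
  have hquot : normSign σ ((u 2 : Kˣ) : K) * normSign σ ((u 1 : Kˣ) : K) = normSign σ y := by
    rw [← normSign_mul_of_fixed hD (hu2 2) (hu2 1) (h0 2) (h0 1),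
      show ((u 2 : Kˣ) : K) * ((u 1 : Kˣ) : K) = y * (((u 1 : Kˣ) : K) * σ ((u 1 : Kˣ) : K)) by rw [hu2 1, hydef]; field_simp, normSign_mul_norm σ _ (h0 1)]
  -- Step A: the corner congruence below the conductor
  have hyq : Valued.v ((y - 1) * (1 + g) / g) ≤ Valued.v ϖ ^ ρ := by
    rw [map_div₀, map_mul, h1g, mul_one, hg, div_le_iff₀ (pow_pos hvϖ _), ← pow_add]; exact hyρ
  have hmain : Valued.v (c * ((y - 1) * (1 + g) / g)) ≤ Valued.v ϖ ^ (Δ + ρ) :=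
    calc Valued.v (c * ((y - 1) * (1 + g) / g)) = Valued.v c * Valued.v ((y - 1) * (1 + g) / g) := map_mul _ _ _
      _ ≤ Valued.v ϖ ^ Δ * Valued.v ϖ ^ ρ := mul_le_mul' hvc hyq
      _ = Valued.v ϖ ^ (Δ + ρ) := (pow_add _ _ _).symm
  have hunit : Valued.v (1 + c * ((y - 1) * (1 + g) / g)) = 1 := Valued.v.map_one_add_of_lt (hmain.trans_lt (pow_lt_one₀ zero_le hϖ1 (by omega)))
  have hunit0 : (1 : K) + c * ((y - 1) * (1 + g) / g) ≠ 0 := fun h => by rw [h, map_zero] at hunit; exact zero_ne_one hunit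
  have hσA : σ (1 + c * ((y - 1) * (1 + g) / g)) = 1 + c * ((y - 1) * (1 + g) / g) := by
    rw [map_add, map_one, map_mul, hσc, map_div₀, map_mul, map_sub, map_one, hσy, map_add, map_one, hσg]
  have hσB : σ (1 + c * (v - 1)) = 1 + c * (v - 1) := by rw [map_add, map_one, map_mul, hσc, map_sub, map_one, hσv]
  have hstepA : normSign σ (1 + c * (v - 1)) = normSign σ (1 + c * ((y - 1) * (1 + g) / g)) := by
    refine normSign_eq_of_near hD hσA hσB hunit (n := Δ + 2 * ρ) (by omega) ?_
    rw [show (1 : K) + c * ((y - 1) * (1 + g) / g) - (1 + c * (v - 1)) = -(c * ((v - 1) - (y - 1) * (1 + g) / g)) by ring, Valuation.map_neg]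
    calc Valued.v (c * ((v - 1) - (y - 1) * (1 + g) / g)) = Valued.v c * Valued.v ((v - 1) - (y - 1) * (1 + g) / g) := map_mul _ _ _
      _ ≤ Valued.v ϖ ^ Δ * Valued.v ϖ ^ (2 * ρ) := mul_le_mul' hvc hcorner
      _ = Valued.v ϖ ^ (Δ + 2 * ρ) := (pow_add _ _ _).symm
  -- Step B∕C: the exact identity `1 + c(y−1)(1+g)∕g = y·(1 + κ(1 − 1∕y))`
  have hident : 1 + c * ((y - 1) * (1 + g) / g) = y * (1 + (r - 1) / (1 + r * g) * (1 - 1 / y)) := by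
    rw [hcdef]; field_simp; ring
  have hK0 : (1 : K) + (r - 1) / (1 + r * g) * (1 - 1 / y) ≠ 0 := fun h => by
    rw [hident, h, mul_zero] at hunit0; exact hunit0 rfl
  have hσK : σ (1 + (r - 1) / (1 + r * g) * (1 - 1 / y)) = 1 + (r - 1) / (1 + r * g) * (1 - 1 / y) := by
    rw [map_add, map_one, map_mul, map_div₀, map_sub, map_one, hσr, hσ1rg, map_sub, map_one, map_div₀, map_one, hσy]
  have h1y : 1 - ((u 1 : Kˣ) : K) / ((u 2 : Kˣ) : K) = 1 - 1 / y := by rw [hydef, one_div, inv_div]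
  rw [← mul_assoc, hquot, hstepA, hident, normSign_mul_of_fixed hD hσy hσK hy0 hK0, ← mul_assoc, normSign_mul_self σ y, one_mul, h1y]

/-! ## §3  The third-slot indicator -/

/-- **`|κ|·|ϖ|^{ρ+2t} ≤ |ϖ|^{2d−1}` ⟹ `ω(u₂)·λ_c(u) = 1` FOR ALL `u ∈ S_F`** (`κ = (r−1)∕(1+rg)`; §2 and a deep one-unit). [cite: Serre1979, Ch. XV §2] [cite: LanglandsShelstad1987, §3] -/
theorem forall_normSign_two_mul_gluedChar_of_le (hD : IsRamifiedQuadraticDatum σ ϖ d t₂) {ρ t : ℕ} (hρ : 1 ≤ ρ) (ht : 1 ≤ t)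
    {g : K} (hσg : σ g = g) (hg : Valued.v g = Valued.v ϖ ^ (2 * t))
    (V : GL (Fin 3) K) (hV : (V : Matrix (Fin 3) (Fin 3) K) = !![1, 0, 0; 1, ϖ ^ ρ, 0; 1 * 1 + g, ϖ ^ ρ * 1, ϖ ^ (2 * ρ + 2 * t)])
    {r : K} (hσr : σ r = r) {Δ : ℕ} (hΔ1 : 1 ≤ Δ) (hrg : Valued.v (r * g) ≤ Valued.v ϖ ^ Δ) (hΔ : 2 * d ≤ Δ + 2 * ρ + 1)
    (hκ : Valued.v ((r - 1) / (1 + r * g)) * Valued.v ϖ ^ (ρ + 2 * t) ≤ Valued.v ϖ ^ (2 * d - 1)) :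
    ∀ u ∈ fixedUnitStabilizer σ (latt (V : Matrix (Fin 3) (Fin 3) K)),
      normSign σ ((u 2 : Kˣ) : K) * (normSign σ ((u 1 : Kˣ) : K) * normSign σ (1 + r * g / (1 + r * g) * (((u 0 : Kˣ) : K) / ((u 1 : Kˣ) : K) - 1))) = 1 := by
  intro u hu
  obtain ⟨hσ, hvσ, hϖ, -, -, -, -⟩ := id hD
  have hϖ0 : ϖ ≠ 0 := (Valuation.ne_zero_iff Valued.v).1 (by rw [hϖ]; exact exp_ne_zero)
  have hϖ1 : Valued.v ϖ < 1 := by rw [hϖ, ← exp_zero, exp_lt_exp]; norm_num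
  obtain ⟨-, hu1, hu2⟩ := (mem_fixedUnitStabilizer_iff σ _ u).1 hu
  have h0 : ∀ j, ((u j : Kˣ) : K) ≠ 0 := fun j => (u j).ne_zero
  have hσ1rg : σ (1 + r * g) = 1 + r * g := by rw [map_add, map_one, map_mul, hσr, hσg]
  rw [normSign_two_mul_gluedChar_eq hD hρ ht hσg hg V hV hσr hΔ1 hrg hΔ hu]
  -- `|κ(1 − u₁∕u₂)| = |κ|·|u₂ − u₁| ≤ |κ|·|ϖ|^{ρ+2t}`
  obtain ⟨-, hyρ, -⟩ := ratios_of_mem_fixedUnitStabilizer_glued_rep (σ := σ) hϖ0 hϖ1 ht hg V hV hu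
  have hw : Valued.v (1 - ((u 1 : Kˣ) : K) / ((u 2 : Kˣ) : K)) ≤ Valued.v ϖ ^ (ρ + 2 * t) := by
    rw [show (1 : K) - ((u 1 : Kˣ) : K) / ((u 2 : Kˣ) : K) = (((u 2 : Kˣ) : K) / ((u 1 : Kˣ) : K) - 1) * (((u 1 : Kˣ) : K) / ((u 2 : Kˣ) : K)) by field_simp,
      map_mul, map_div₀, hu1, hu1, div_one, mul_one]
    exact hyρ
  refine normSign_eq_one_of_fixed_of_v_sub_one_le hD ?_ (n := 2 * d - 1) le_rfl ?_
  · rw [map_add, map_one, map_mul, map_div₀, map_sub, map_one, hσr, hσ1rg, map_sub, map_one, map_div₀, hu2, hu2]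
  · rw [add_sub_cancel_left, map_mul]
    exact (mul_le_mul_right hw _).trans hκ

/-- **`|ϖ|^{2d−2} ≤ |κ|·|ϖ|^{ρ+2t}` ⟹ SOME `u ∈ S_F` HAS `ω(u₂)·λ_c(u) ≠ 1`** (`|2| < 1`): with the non-norm `n₀ ≡ 1 (ϖ^{2d−2})` of ★ `exists_fixed_unit_not_norm_v_sub_one_le`, the carrier of
§1 at `1 − u₁∕u₂ = (n₀ − 1)∕κ` (`|·| ≤ |ϖ|^{ρ+2t}`) reads `ω(n₀) = −1` by §2. [cite: Serre1979, Ch. V §3 Prop. 5, Cor. 3] [cite: LanglandsShelstad1987, §3] -/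
theorem exists_normSign_two_mul_gluedChar_ne_one (hD : IsRamifiedQuadraticDatum σ ϖ d t₂) (h2 : Valued.v (2 : K) < 1) {ρ t : ℕ} (hρ : 1 ≤ ρ) (ht : 1 ≤ t)
    {g : K} (hσg : σ g = g) (hg : Valued.v g = Valued.v ϖ ^ (2 * t))
    (V : GL (Fin 3) K) (hV : (V : Matrix (Fin 3) (Fin 3) K) = !![1, 0, 0; 1, ϖ ^ ρ, 0; 1 * 1 + g, ϖ ^ ρ * 1, ϖ ^ (2 * ρ + 2 * t)])
    {r : K} (hσr : σ r = r) {Δ : ℕ} (hΔ1 : 1 ≤ Δ) (hrg : Valued.v (r * g) ≤ Valued.v ϖ ^ Δ) (hΔ : 2 * d ≤ Δ + 2 * ρ + 1)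
    (hκ : Valued.v ϖ ^ (2 * (d - 1)) ≤ Valued.v ((r - 1) / (1 + r * g)) * Valued.v ϖ ^ (ρ + 2 * t)) :
    ∃ u ∈ fixedUnitStabilizer σ (latt (V : Matrix (Fin 3) (Fin 3) K)),
      normSign σ ((u 2 : Kˣ) : K) * (normSign σ ((u 1 : Kˣ) : K) * normSign σ (1 + r * g / (1 + r * g) * (((u 0 : Kˣ) : K) / ((u 1 : Kˣ) : K) - 1))) ≠ 1 := by
  obtain ⟨hσ, hvσ, hϖ, -, -, -, -⟩ := id hD
  have hϖ0 : ϖ ≠ 0 := (Valuation.ne_zero_iff Valued.v).1 (by rw [hϖ]; exact exp_ne_zero)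
  have hvϖ : 0 < Valued.v ϖ := (Valuation.pos_iff _).2 hϖ0
  have hϖ1 : Valued.v ϖ < 1 := by rw [hϖ, ← exp_zero, exp_lt_exp]; norm_num
  have hσ1rg : σ (1 + r * g) = 1 + r * g := by rw [map_add, map_one, map_mul, hσr, hσg]
  set κ : K := (r - 1) / (1 + r * g) with hκdef
  have hσκ : σ κ = κ := by rw [hκdef, map_div₀, map_sub, map_one, hσr, hσ1rg]
  -- `κ ≠ 0`
  have hvκ0 : Valued.v κ ≠ 0 := fun h0 => by
    rw [h0, zero_mul] at hκ; exact (pow_ne_zero _ hvϖ.ne') (le_antisymm hκ zero_le)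
  have hκ0 : κ ≠ 0 := (Valuation.ne_zero_iff _).1 hvκ0
  -- the non-norm and the ratio `e′ = (n₀ − 1)∕κ`
  obtain ⟨n₀, hσn₀, hn₀1, hn₀d, hn₀n⟩ := exists_fixed_unit_not_norm_v_sub_one_le hD h2
  have hn₀d' : Valued.v (n₀ - 1) ≤ Valued.v ϖ ^ (2 * (d - 1)) := by
    rw [v_varpi_pow hϖ]; convert hn₀d using 2; push_cast; ring
  set e' : K := (n₀ - 1) / κ with he'def
  have hσe' : σ e' = e' := by rw [he'def, map_div₀, map_sub, map_one, hσn₀, hσκ]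
  have he' : Valued.v e' ≤ Valued.v ϖ ^ (ρ + 2 * t) := by
    rw [he'def, map_div₀, div_le_iff₀ (zero_lt_iff.2 hvκ0), mul_comm]
    exact hn₀d'.trans hκ
  have he'lt : Valued.v e' < 1 := he'.trans_lt (pow_lt_one₀ zero_le hϖ1 (by omega))
  -- `y = 1∕(1 − e′)`, `e = y − 1 = e′∕(1 − e′)`
  have h1e' : Valued.v (1 - e') = 1 := by rw [sub_eq_add_neg]; exact Valued.v.map_one_add_of_lt (by rw [Valuation.map_neg]; exact he'lt)
  have h1e'0 : (1 : K) - e' ≠ 0 := fun h0 => by rw [h0, map_zero] at h1e'; exact zero_ne_one h1e'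
  have he : Valued.v (e' / (1 - e')) ≤ Valued.v ϖ ^ (ρ + 2 * t) := by rw [map_div₀, h1e', div_one]; exact he'
  obtain ⟨u, hu, hu0, hu1, hu2⟩ := exists_mem_fixedUnitStabilizer_glued_rep_of_ratio₂ hϖ0 hϖ1 hρ ht hσg hg V hV
    (by rw [map_div₀, map_sub, map_one, hσe']) he
  refine ⟨u, hu, ?_⟩
  rw [normSign_two_mul_gluedChar_eq hD hρ ht hσg hg V hV hσr hΔ1 hrg hΔ hu, hu1, hu2,
    show (1 : K) - 1 / (1 + e' / (1 - e')) = e' by field_simp; ring, ← hκdef, he'def, mul_div_cancel₀ _ hκ0, add_sub_cancel,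
    normSign_of_not_isNorm σ hn₀n]
  norm_num

end Character

end Summit.HodgeConjecture.HodgeConjecture.Cruxes.H413.F0P3cDyRamLabelledOddGluedCharacterTwo

end
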